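import Summits.CriticalPhenomena.Ising3DConformalLimit.Theses.PerfectScreening
import Literature.Probability.LatticeModels.TorusZeroMode
import Literature.Probability.LatticeModels.InfraredLongRangeOrder
import Literature.Probability.LatticeModels.GaussianDominationProofs

/-!
# Order beyond the infrared threshold (crux stmt-CriticalPhenomena-1341, line `certified-core-eventual-tail`,
stub `stub_order_beyond_threshold`; lead `prover-line-stmt-CriticalPhenomena-1341-0`)

The Fröhlich–Simon–Spencer mechanism for the nearest-neighbour Ising model on `ℤ^d`, `d ≥ 3`,
FULLY PROVED from tree theorems (no named facts taken as hypotheses):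

* `ccetOrder_torusZeroMode_ge` — **torus long-range order from the infrared bound** (finite volume):
  on the torus `(ℤ/Lℤ)^d`, `L` even, `L ≠ 2`, `β > 0`,
  `1 - torusGreen 0 / (2β) ≤ torusZeroMode d L β = L^{-d} ∑_x ⟨σ₀σ_x⟩_{𝕋_L,β}`
  (the sum rule `⟨σ₀σ₀⟩ = 1 = L^{-d} ∑_k Ĝ_L(k)` against the infrared bound
  `Ĝ_L(k) ≤ 1/(2β ε(p_k))`, `k ≠ 0`; tree theorems `infraredBound_holds`,
  `sub_mul_torusGreen_le_zeroMode`);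
* `ccetOrder_one_sub_latticeGreen_le_sq` — **the spontaneous magnetisation is bounded below**:
  `1 - latticeGreen 0 / (2β) ≤ m*(β)²` for `d ≥ 3`, `β > 0`. Proof: the torus zero mode is ALSO
  bounded above by the plus-box magnetisation, `torusZeroMode d L β ≤ (4R+3)^d/L^d + (⟨σ₀⟩⁺_{Λ_R;β})²`
  (tree theorem `torusZeroMode_le`: GKS II shrinks the torus to two far `+`-boxes, Friedli–Velenik
  2017 Exercise 3.15), so letting `L → ∞` along even `L` (`torusGreen 0 → latticeGreen 0`,
  `torusGreen_tendsto_latticeGreen`) and then `R → ∞` (`⟨σ₀⟩⁺_{Λ_R;β} → m*(β)`,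
  `hasBoxLimit_isingCorr_plus_holds`) gives the claim — no infinite-volume torus state, no
  Messager–Miracle-Solé, no uniqueness theory is needed;
* `ccetOrder_spontaneousMagnetization_pos` — `latticeGreen 0 < 2β ⇒ 0 < m*(β)`, and
  `ccetOrder_criticalBeta_le` — **`β_c(d) ≤ latticeGreen 0 / 2`** (`= G₀(0) = 0.2527…` for `d = 3`,
  Watson's integral; the only previous tree bound was Peierls', `β_c(3) ≤ 2.08`);
* `ccetOrder_order_beyond_threshold_of_latticeGreen_le` — the registered stub
  `∀ β, 13/50 < β → 0 < spontaneousMagnetization 3 β` REDUCED to the single certified numerical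
  enclosure `latticeGreen (0 : Site 3) ≤ 13/25` (true value `0.50546…`, margin 2.9 %), which is the
  remaining blocker of the stub (no enclosure of Watson's integral is in the tree).

References: J. Fröhlich, B. Simon, T. Spencer, Comm. Math. Phys. 50 (1976) 79–95, §3 (Thm. 3.1 and
the sum-rule argument); S. Friedli, Y. Velenik, *Statistical Mechanics of Lattice Systems* (CUP 2017),
Thm. 10.24, §10.5, Exercise 3.15; M. Aizenman, H. Duminil-Copin, V. Sidoravicius, Comm. Math. Phys.
334 (2015), §3.3 (the torus zero mode).
-/

noncomputable section

namespace Summit.CriticalPhenomena.Ising3DConformalLimit.Theorems.PerfectScreening.CcetOrder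

open MeasureTheory Filter Topology Finset
open Literature.Probability.LatticeModels

variable {d : ℕ}

/-- **Torus long-range order from the infrared bound (zero-mode form).** For the nearest-neighbour
Ising model on `(ℤ/Lℤ)^d`, `L` even, `L ≠ 2`, `β > 0`:
`1 - torusGreen 0 / (2β) ≤ L^{-d} ∑_x ⟨σ₀σ_x⟩_{𝕋_L,β}` (Fröhlich–Simon–Spencer 1976, §3: the sum
rule `1 = ⟨σ₀σ₀⟩ = L^{-d} ∑_k Ĝ_L(k)` with `Ĝ_L(k) ≤ 1/(2β ε(p_k))` for `k ≠ 0`). -/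
theorem ccetOrder_torusZeroMode_ge (L : ℕ) [NeZero L] (hL : Even L) (hL2 : L ≠ 2) {β : ℝ}
    (hβ : 0 < β) :
    1 - torusGreen (0 : TorusSite d L) / (2 * β) ≤ torusZeroMode d L β := by
  set μ := isingTorusMeasure d L β 0 with hμ
  have hG : ∀ x, isingTorusTwoPoint d L β 0 0 x = torusTwoPoint μ x := fun x => by
    rw [isingTorusTwoPoint_eq_torusTwoPoint, sub_zero]
  have hIR : ∀ k : TorusSite d L, k ≠ 0 →
      dispersion (latticeMomentum L k) *
        (torusFourier (fun x => (torusTwoPoint μ x : ℂ)) k).re ≤ 1 / (2 * β) := by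
    intro k hk
    have h : (torusFourier (fun x => (torusTwoPoint μ x : ℂ)) k).re ≤
        1 / (2 * β * dispersion (latticeMomentum L k)) :=
      infraredBound_holds (d := d) (L := L) hL hL2 hβ k hk
    have hεpos : 0 < dispersion (latticeMomentum L k) :=
      lt_of_le_of_ne (dispersion_nonneg _)
        (fun h0 => hk ((dispersion_latticeMomentum_eq_zero_iff_holds k).1 h0.symm))
    calc dispersion (latticeMomentum L k) *
          (torusFourier (fun x => (torusTwoPoint μ x : ℂ)) k).re
        ≤ dispersion (latticeMomentum L k) * (1 / (2 * β * dispersion (latticeMomentum L k))) :=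
          mul_le_mul_of_nonneg_left h hεpos.le
      _ = 1 / (2 * β) := by field_simp
  have hsum := sub_mul_torusGreen_le_zeroMode (fun x => torusTwoPoint μ x) hIR
  rw [torusFourier_apply_zero] at hsum
  simp only [torusTwoPoint_zero, Complex.re_sum, Complex.ofReal_re] at hsum
  have hZ : torusZeroMode d L β = ((L : ℝ) ^ d)⁻¹ * ∑ x, torusTwoPoint μ x := by
    simp only [torusZeroMode, hG, div_eq_inv_mul]
  rw [hZ]
  have h1 : 1 - torusGreen (0 : TorusSite d L) / (2 * β) =
      1 - 1 / (2 * β) * torusGreen (0 : TorusSite d L) := by ring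
  rw [h1]
  exact hsum

/-- **The Fröhlich–Simon–Spencer lower bound on the spontaneous magnetisation** (`d ≥ 3`, `β > 0`):
`1 - latticeGreen 0 / (2β) ≤ m*(β)²`. The torus zero mode is squeezed between the infrared lower
bound `ccetOrder_torusZeroMode_ge` and the two-box GKS upper bound
`torusZeroMode d L β ≤ (4R+3)^d/L^d + (⟨σ₀⟩⁺_{Λ_R;β})²` (`torusZeroMode_le`, Friedli–Velenik 2017,
Exercise 3.15 on the torus); let `L → ∞` along even `L` (`torusGreen_tendsto_latticeGreen`), then
`R → ∞` (`⟨σ₀⟩⁺_{Λ_R;β} → m*(β)`, `hasBoxLimit_isingCorr_plus_holds`). -/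
theorem ccetOrder_one_sub_latticeGreen_le_sq : ∀ {d : ℕ}, 3 ≤ d → ∀ {β : ℝ}, 0 < β →
    1 - latticeGreen (0 : Site d) / (2 * β) ≤ spontaneousMagnetization d β ^ 2 := by
  intro d hd β hβ
  have hd1 : 1 ≤ d := le_trans (by norm_num) hd
  -- Step 1: the bound holds for every finite plus box `Λ_R`
  have hR : ∀ R : ℕ, 1 - latticeGreen (0 : Site d) / (2 * β) ≤
      (isingExpect (zdGraph d) (box d R) β 0 .plus (spinAt 0)) ^ 2 := by
    intro R
    refine le_of_forall_pos_le_add fun ε hε => ?_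
    -- `torusGreen 0` is within `ε β` of `latticeGreen 0` for large even `L`
    obtain ⟨L₀, hL₀⟩ := torusGreen_tendsto_latticeGreen d hd (0 : Site d) (ε := ε * β)
      (by positivity)
    -- the near-field correction `(4R+3)^d / L^d` is `< ε/2` for large `L`
    have hpow : Tendsto (fun L : ℕ => ((4 * R + 3 : ℝ) ^ d) / ((L : ℝ) ^ d)) atTop (𝓝 0) := by
      have h1 : Tendsto (fun L : ℕ => ((L : ℝ) ^ d)⁻¹) atTop (𝓝 0) := by
        have := (tendsto_pow_atTop (α := ℝ) (n := d) (by omega)).comp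
          tendsto_natCast_atTop_atTop
        exact this.inv_tendsto_atTop
      simpa [div_eq_mul_inv] using h1.const_mul ((4 * R + 3 : ℝ) ^ d)
    obtain ⟨L₁, hL₁⟩ := eventually_atTop.1
      (hpow.eventually (gt_mem_nhds (show (0 : ℝ) < ε / 2 by linarith)))
    -- one large even torus
    set M : ℕ := max (max L₀ L₁) (2 * R + 4) with hM
    set L : ℕ := 2 * M with hLM
    have hM1 : 2 * R + 4 ≤ M := le_max_right _ _
    have hM2 : L₀ ≤ M := le_trans (le_max_left _ _) (le_max_left _ _)
    have hM3 : L₁ ≤ M := le_trans (le_max_right _ _) (le_max_left _ _)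
    haveI : NeZero L := ⟨by omega⟩
    have hLeven : Even L := ⟨M, two_mul M⟩
    have hL2 : L ≠ 2 := by omega
    have hRL : 2 * R + 3 < L := by omega
    have h1 := ccetOrder_torusZeroMode_ge (d := d) L hLeven hL2 hβ
    have h2 := torusZeroMode_le (d := d) (L := L) (R := R)
      (fun Λ A B β' h bc => GKSInequalities.gks_two_holds (torusGraph d L)) hRL hβ.le
    have h3 := hL₀ L hLeven (by omega)
    rw [torusProj_zero] at h3
    have h4 := hL₁ L (by omega)
    have h5 : torusGreen (0 : TorusSite d L) / (2 * β) ≤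
        latticeGreen (0 : Site d) / (2 * β) + ε / 2 := by
      have hb : torusGreen (0 : TorusSite d L) ≤ latticeGreen (0 : Site d) + ε * β := by
        linarith [(abs_le.1 h3).2]
      calc torusGreen (0 : TorusSite d L) / (2 * β)
          ≤ (latticeGreen (0 : Site d) + ε * β) / (2 * β) :=
            div_le_div_of_nonneg_right hb (by positivity)
        _ = latticeGreen (0 : Site d) / (2 * β) + ε / 2 := by field_simp
    linarith
  -- Step 2: `⟨σ₀⟩⁺_{Λ_R;β} → m*(β)` as `R → ∞`
  have hlim := (tendsto_isingExpect_plus_spinAt hasBoxLimit_isingCorr_plus_holds hβ.le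
    (0 : Site d)).pow 2
  exact ge_of_tendsto hlim (Eventually.of_forall hR)

/-- `latticeGreen 0 ≥ 0` for `d ≥ 3`, read off `ccetOrder_one_sub_latticeGreen_le_sq` at `β = 1`
and `m* ≤ 1` (so that this file does not depend on the potential-theory files proving
`latticeGreen > 0`). -/
theorem ccetOrder_latticeGreen_zero_nonneg (hd : 3 ≤ d) : 0 ≤ latticeGreen (0 : Site d) := by
  have h1 := ccetOrder_one_sub_latticeGreen_le_sq hd (β := 1) one_pos
  have hm1 : spontaneousMagnetization d 1 ≤ 1 := spontaneousMagnetization_le_one_holds zero_le_one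
  have hm0 : 0 ≤ spontaneousMagnetization d 1 := spontaneousMagnetization_nonneg_holds zero_le_one
  nlinarith

/-- **Spontaneous magnetisation beyond the infrared threshold** (`d ≥ 3`): if
`latticeGreen 0 < 2β` then `m*(β) > 0` (Fröhlich–Simon–Spencer 1976, Thm. 3.1 with §3;
Friedli–Velenik 2017, §10.5). -/
theorem ccetOrder_spontaneousMagnetization_pos (hd : 3 ≤ d) {β : ℝ} (hβ : 0 < β)
    (hG : latticeGreen (0 : Site d) < 2 * β) : 0 < spontaneousMagnetization d β := by
  have h1 := ccetOrder_one_sub_latticeGreen_le_sq hd hβ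
  have hpos : 0 < 1 - latticeGreen (0 : Site d) / (2 * β) := by
    rw [sub_pos, div_lt_one (by positivity)]
    exact hG
  have hm0 : 0 ≤ spontaneousMagnetization d β := spontaneousMagnetization_nonneg_holds hβ.le
  rcases hm0.lt_or_eq with h | h
  · exact h
  · rw [← h] at h1
    linarith

/-- **`β_c(d) ≤ latticeGreen 0 / 2`** for `d ≥ 3` (the infrared upper bound on the critical
inverse temperature; for `d = 3`, `latticeGreen 0 / 2 = G₀(0) = 0.25273…`, Watson's integral). -/
theorem ccetOrder_criticalBeta_le (hd : 3 ≤ d) :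
    criticalBeta d ≤ latticeGreen (0 : Site d) / 2 := by
  refine le_of_forall_gt_imp_ge_of_dense fun b hb => ?_
  have hb0 : 0 < b := lt_of_le_of_lt (by linarith [ccetOrder_latticeGreen_zero_nonneg hd]) hb
  show sInf {β : ℝ | 0 ≤ β ∧ 0 < spontaneousMagnetization d β} ≤ b
  exact csInf_le ⟨0, fun _ hβ => hβ.1⟩
    ⟨hb0.le, ccetOrder_spontaneousMagnetization_pos hd hb0 (by linarith)⟩

/-- **The registered stub reduced to one number.** If `latticeGreen (0 : Site 3) ≤ 13/25`
(numerically `latticeGreen 0 = 2 G₀(0) = 0.50546…`, Watson 1939), then the nearest-neighbour Ising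
model on `ℤ³` is ordered at every `β > 13/50`: this is exactly the signature of
`stub_order_beyond_threshold` of the line `certified-core-eventual-tail`. -/
theorem ccetOrder_order_beyond_threshold_of_latticeGreen_le : latticeGreen (0 : Site 3) ≤ 13 / 25 →
    ∀ β : ℝ, 13 / 50 < β → 0 < spontaneousMagnetization 3 β := fun hG β hβ =>
  ccetOrder_spontaneousMagnetization_pos (d := 3) (by norm_num) (by linarith) (by linarith)

end Summit.CriticalPhenomena.Ising3DConformalLimit.Theorems.PerfectScreening.CcetOrder

end
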